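import Literature.MathematicalPhysics.QuantumLattice.HubbardFermiCurve
import Mathlib.Analysis.SpecialFunctions.Trigonometric.Bounds
import Mathlib.Analysis.SpecialFunctions.Trigonometric.Deriv
import HarnessLib

/-!
# The radial Fermi velocity of the square-lattice dispersion is bounded below

Topic `Literature/MathematicalPhysics/QuantumLattice`; continues `HubbardFermiCurve.lean`.  The
representation (1.5) of Benfatto–Giuliani–Mastropietro 2006,
`Ŝ₀(k) = 1/(-ik₀ + v_F(θ)·(k - p_F(θ)) + R(k))`, and the statement of their Thm. 1.1 that the
functions `a(θ), |b(θ)|, |c(θ)|` "are bounded above and below by positive `O(1)` constants" rest on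
the transversality of the rays to the Fermi curve: the radial derivative of the dispersion,
`(d/dt) ε(t k)|_{t=1} = ∇ε(k)·k = 2 Σᵢ kᵢ sin kᵢ`, is bounded below on the Fermi curve.  For
`ε(k) = -2(cos k₁ + cos k₂)` and `μ > -4` this file proves

* `hasDerivAt_sqDispersion_ray` — the derivative of `t ↦ ε(t k)`; `radialDeriv k = 2 Σᵢ kᵢ sin kᵢ` is
  its value at `t = 1`;
* `div_mul_sq_le_mul_sin` — Jordan's inequality in the form `(2/π) x² ≤ x sin x` for `|x| ≤ π/2`;
  `sqDispersion_add_four_le` — `ε(k) + 4 ≤ |k|²` (`1 - x²/2 ≤ cos x`);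
* `le_radialDeriv_of_sqDispersion_eq` — **on the Fermi curve `{ε = μ}` inside `[-π/2, π/2]²`,
  `∇ε(k)·k ≥ (4/π)(μ + 4) > 0`**, uniformly in the direction.

Everything is proved; no named fact. [folklore]

## Sources

G. Benfatto, A. Giuliani, V. Mastropietro, Ann. Henri Poincaré 7 (2006), §1 (1.5) and Thm. 1.1
(`BenfattoGiulianiMastropietro2006`).
-/

noncomputable section

open Real Set

namespace Literature.MathematicalPhysics.QuantumLattice

/-- The radial derivative `∇ε(k)·k = 2 Σᵢ kᵢ sin kᵢ` of the dispersion. [folklore] -/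
def radialDeriv (k : Fin 2 → ℝ) : ℝ := 2 * (k 0 * Real.sin (k 0) + k 1 * Real.sin (k 1))

/-- **The derivative of the dispersion along a ray**:
`(d/dt) ε(t k) = 2 (k₁ sin (t k₁) + k₂ sin (t k₂))`. [folklore] -/
theorem hasDerivAt_sqDispersion_ray (k : Fin 2 → ℝ) (t : ℝ) :
    HasDerivAt (fun s : ℝ => sqDispersion (s • k)) (2 * (k 0 * Real.sin (t * k 0) + k 1 * Real.sin (t * k 1))) t := by
  have h0 : HasDerivAt (fun s : ℝ => Real.cos (s * k 0)) (-Real.sin (t * k 0) * (1 * k 0)) t :=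
    ((hasDerivAt_id t).mul_const (k 0)).cos
  have h1 : HasDerivAt (fun s : ℝ => Real.cos (s * k 1)) (-Real.sin (t * k 1) * (1 * k 1)) t :=
    ((hasDerivAt_id t).mul_const (k 1)).cos
  have h := (h0.add h1).const_mul (-2 : ℝ)
  have hfun : (fun s : ℝ => sqDispersion (s • k)) = fun s => -2 * (Real.cos (s * k 0) + Real.cos (s * k 1)) := by
    funext s; simp [sqDispersion, smul_eq_mul]
  rw [hfun]
  exact h.congr_deriv (by ring)

/-- Its value at `t = 1` is `radialDeriv k`. [folklore] -/
theorem hasDerivAt_sqDispersion_ray_one (k : Fin 2 → ℝ) :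
    HasDerivAt (fun s : ℝ => sqDispersion (s • k)) (radialDeriv k) 1 := by
  have h := hasDerivAt_sqDispersion_ray k 1
  rwa [one_mul, one_mul] at h

/-- **Jordan's inequality, symmetric form**: `(2/π) x² ≤ x sin x` for `|x| ≤ π/2`. [folklore] -/
theorem div_mul_sq_le_mul_sin {x : ℝ} (hx : |x| ≤ π / 2) : 2 / π * x ^ 2 ≤ x * Real.sin x := by
  rcases le_total 0 x with h | h
  · have hj := Real.mul_le_sin h (abs_of_nonneg h ▸ hx)
    calc 2 / π * x ^ 2 = x * (2 / π * x) := by ring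
      _ ≤ x * Real.sin x := mul_le_mul_of_nonneg_left hj h
  · have h' : 0 ≤ -x := neg_nonneg.2 h
    have hj := Real.mul_le_sin h' (by rwa [abs_of_nonpos h] at hx)
    rw [Real.sin_neg] at hj
    calc 2 / π * x ^ 2 = (-x) * (2 / π * (-x)) := by ring
      _ ≤ (-x) * (-Real.sin x) := mul_le_mul_of_nonneg_left hj h'
      _ = x * Real.sin x := by ring

/-- `ε(k) + 4 ≤ |k|²` (from `1 - x²/2 ≤ cos x`). [folklore] -/
theorem sqDispersion_add_four_le (k : Fin 2 → ℝ) : sqDispersion k + 4 ≤ k 0 ^ 2 + k 1 ^ 2 := by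
  have h0 := Real.one_sub_sq_div_two_le_cos (x := k 0)
  have h1 := Real.one_sub_sq_div_two_le_cos (x := k 1)
  unfold sqDispersion; linarith

/-- The radial derivative dominates `(4/π)|k|²` on `[-π/2, π/2]²`. [folklore] -/
theorem div_mul_sq_le_radialDeriv {k : Fin 2 → ℝ} (hk : ∀ i, |k i| ≤ π / 2) :
    4 / π * (k 0 ^ 2 + k 1 ^ 2) ≤ radialDeriv k := by
  have h0 := div_mul_sq_le_mul_sin (hk 0)
  have h1 := div_mul_sq_le_mul_sin (hk 1)
  calc 4 / π * (k 0 ^ 2 + k 1 ^ 2) = 2 * (2 / π * k 0 ^ 2 + 2 / π * k 1 ^ 2) := by ring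
    _ ≤ 2 * (k 0 * Real.sin (k 0) + k 1 * Real.sin (k 1)) := mul_le_mul_of_nonneg_left (add_le_add h0 h1) two_pos.le
    _ = radialDeriv k := rfl

/-- **The radial Fermi velocity is bounded below** (transversality of the rays to the Fermi curve,
Benfatto–Giuliani–Mastropietro 2006, (1.5) and Thm. 1.1: `a(θ)` bounded below): on `{ε = μ}`
inside `[-π/2, π/2]²`, `∇ε(k)·k ≥ (4/π)(μ + 4)`, which is positive for `μ > -4`. [cite: BenfattoGiulianiMastropietro2006, §1 (1.5)] -/
theorem le_radialDeriv_of_sqDispersion_eq {μ : ℝ} {k : Fin 2 → ℝ} (hk : ∀ i, |k i| ≤ π / 2)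
    (he : sqDispersion k = μ) : 4 / π * (μ + 4) ≤ radialDeriv k := by
  have h1 := sqDispersion_add_four_le k
  rw [he] at h1
  have hπ : 0 ≤ 4 / π := by positivity
  exact (mul_le_mul_of_nonneg_left h1 hπ).trans (div_mul_sq_le_radialDeriv hk)

/-- In particular the radial derivative is positive on the Fermi curve for `μ > -4`. [folklore] -/
theorem radialDeriv_pos_of_sqDispersion_eq {μ : ℝ} (hμ : -4 < μ) {k : Fin 2 → ℝ} (hk : ∀ i, |k i| ≤ π / 2)
    (he : sqDispersion k = μ) : 0 < radialDeriv k :=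
  lt_of_lt_of_le (mul_pos (by positivity) (by linarith)) (le_radialDeriv_of_sqDispersion_eq hk he)

end Literature.MathematicalPhysics.QuantumLattice
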